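/-
Copyright: b2b-lace cell (CriticalPhenomena). Text-final: lean1-g45 draft 2 + LEAD l.4334 header edit, filed by lean1-g50 under
the LEAD's lift STATUS l.4310 (1) ∕ REFEREE v218 R1410; D98-neutral split identities; no numeral; d-generic.
-/
import Literature.Probability.FitznerVanDerHofstad2017.NobleWeightedN1Assembly
import HarnessLib

/-!
# [FvdH17] Lemma 5.1 VERSION 2 (raw): the diagonal ∕ off-diagonal split of the one-side-trivial pieces `R_R(ι,a)`, `R_L(ι,b)`

CITATION HEADER (PLACEMENT v2). This module is part of a certified REPRODUCTION of:
R. Fitzner, R. van der Hofstad, *Mean-field behavior for nearest-neighbor percolation in `d > 10`*, Electron. J.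
Probab. **22** (2017) no. 43 [FvdH17] (arXiv:1506.07977v2): §4.4 (4.65) (p. 43, the weighted diagram `Ξ^{(1)}`),
Lemma 5.1 second version (p. 50, the bound with the two one-side-trivial sums `R_R`, `R_L` carried raw) and §6.1
(p. 59).  Origin: build `lace` (host summit CriticalPhenomena), LEAN TYPING SEAT 1; node N76-XI1DELTA ∕ W3, desk
object T1 of the LEAD (carver-g58, STATUS l.4287, read l.4300).

WHAT THIS FILE DOES (all `d`-generic; every letter family — the start letters `Sn`, the exit letters `En`, the
four-point family `Ab` — is a PARAMETER; no percolation event, no inequality between letters, no numeral).  The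
objects are the tree's `rawRPieceOff0 Sn Ab ι a` (the `w ≠ 0` part of `R_R(ι,a) = Σ_{x,u,w} ‖x‖₂² (P^S−u⃗)_a(u,w)
Ā^{ι,a,0}(u,w,x,x)`, right/exit triangle trivial) and `rawLPiece Ab En ι b` (`R_L(ι,b) = Σ_{x,t,z} ‖x‖₂²
Ā^{ι,0,b}(0,0,t,z) (P^E−u⃗)_b(t−x,z−x)`, left/start triangle trivial) of `NobleWeightedN1Assembly`.  SCOPE in print's
words: App. C.1 of the extended version (pp. 79–80) treats the right-trivial diagram by the position of `u, w`
("a) `u = w ≠ 0`, b) `w = 0, u ≠ w`, c) `u, w` are directly connected by a bond and d) the remaining cases") and the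
left-trivial one "in the same way"; `rawRPieceOff0` is the range `w ≠ 0` of that diagram.
* RIGHT: `rawRPieceOff0 Sn Ab ι a = rawRDiag Sn Ab ι a + rawROffDiag Sn Ab ι a` — the DIAGONAL `x = w` (the end
  point `x` coincides with the start-triangle vertex `w`; weight `‖w‖₂²` there) and the OFF-DIAGONAL remainder
  `x ≠ w`; with `rawRPiece_eq_at0_add_off0` the three-way form `rawRPiece = rawRPieceAt0 + rawRDiag + rawROffDiag`.
* LEFT: `rawLPiece Ab En ι b = rawLDiag Ab En ι b + rawLOffDiag Ab En ι b` — the DIAGONAL `t = e_ι` (the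
  exit-triangle vertex `t` coincides with the far end `e_ι` of the first pivotal bond `(0, e_ι)`; in the typed block
  `NobleBlocks.blockAiota₀` this is the Kronecker addend `kd x e` of row `(0,1)`, App. B Table "definition of
  `A^{ι,a,b}(0,v,x,y)`", v2 p. 75) and the OFF-DIAGONAL remainder `t ≠ e_ι`.
* The monotonicity one-liners (each part `≤` the piece) and the summed forms over `(ι,a)` ∕ `(ι,b)`.
The split `1 = δ + (1 − δ)` under the sums is elementary algebra over the tree's objects and is NOT a case
distinction made in print (DIVERGENCE D98 ∕ GAPS G-D98 of the packet record what print's App. C.1 letters do and do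
not separate; nothing of that is decided or used here).  Nothing landed is modified; no cited hypothesis — every
statement is a definition or a kernel-proved identity ∕ monotonicity.
-/

noncomputable section

namespace Literature.Probability.FitznerVanDerHofstad2017

open scoped BigOperators ENNReal
open Literature.Probability.LatticeModels Literature.Probability.Percolation
open Literature.Probability.FitznerVanDerHofstad2017.BlockSummation
open Literature.Probability.FitznerVanDerHofstad2017.NobleBlocks

variable {d : ℕ}

/-! ## A. Right side trivial, `w ≠ 0`: the diagonal `x = w` and its complement -/

/-- **The diagonal `x = w` of the `w ≠ 0` part of `R_R(ι,a)`**: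
`Σ_{u,w} ‖w‖₂² (1 − δ_{w,0}) (P^S−u⃗)_a(u,w) Ā^{ι,a,0}(u,w,w,w)` — the configurations of the right-trivial diagram with
`w ≠ 0` (the range of print's App. C.1 Cases c), d)) in which the end point `x` equals the start-triangle vertex `w`.
Object only; no bound is attached here.
[cite: FitznerVanDerHofstad2017, §4.4 (4.65) (arXiv:1506.07977v2 p. 43); Lemma 5.1 second version (p. 50)] -/
def rawRDiag (Sn : Fin 3 → Site d → Site d → ℝ≥0∞) (Ab : DirBlockFamily d) (ι : Fin d × Bool) (a : Fin 3) : ℝ≥0∞ :=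
  ∑' u, ∑' w, wt w * (kdc w 0 * (Sn a u w * Ab ι a 0 u w w w))

/-- **The off-diagonal `x ≠ w` remainder of the `w ≠ 0` part of `R_R(ι,a)`**:
`Σ_{x,u,w} ‖x‖₂² (1 − δ_{x,w}) (1 − δ_{w,0}) (P^S−u⃗)_a(u,w) Ā^{ι,a,0}(u,w,x,x)`. Object only.
[cite: FitznerVanDerHofstad2017, §4.4 (4.65) (arXiv:1506.07977v2 p. 43); Lemma 5.1 second version (p. 50)] -/
def rawROffDiag (Sn : Fin 3 → Site d → Site d → ℝ≥0∞) (Ab : DirBlockFamily d) (ι : Fin d × Bool) (a : Fin 3) : ℝ≥0∞ :=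
  ∑' x, ∑' u, ∑' w, wt x * (kdc x w * (kdc w 0 * (Sn a u w * Ab ι a 0 u w x x)))

/-- **`[w ≠ 0 part of R_R(ι,a)] = [diagonal x = w] + [off-diagonal x ≠ w]`**: the insertion of
`1 = δ_{x,w} + (1 − δ_{x,w})` under the sum — elementary algebra over the tree's objects, valid for every start-letter
family `Sn` and every four-point family `Ab`; not a case distinction made in print.
[cite: FitznerVanDerHofstad2017, §4.4 (4.65) (arXiv:1506.07977v2 p. 43); Lemma 5.1 second version (p. 50)] -/
theorem rawRPieceOff0_eq_diag_add_offDiag (Sn : Fin 3 → Site d → Site d → ℝ≥0∞) (Ab : DirBlockFamily d)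
    (ι : Fin d × Bool) (a : Fin 3) :
    rawRPieceOff0 Sn Ab ι a = rawRDiag Sn Ab ι a + rawROffDiag Sn Ab ι a := by
  unfold rawRPieceOff0 rawRDiag rawROffDiag
  -- bring the `x`-sum innermost: `Σ_x Σ_u Σ_w F = Σ_u Σ_w Σ_x F`
  rw [tsum_rot₃ (fun x u w => wt x * (kdc w 0 * (Sn a u w * Ab ι a 0 u w x x))),
    tsum_rot₃ (fun x u w => wt x * (kdc x w * (kdc w 0 * (Sn a u w * Ab ι a 0 u w x x)))), ← ENNReal.tsum_add]
  refine tsum_congr fun u => ?_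
  rw [← ENNReal.tsum_add]
  refine tsum_congr fun w => ?_
  have hsplit : ∀ x, wt x * (kdc w 0 * (Sn a u w * Ab ι a 0 u w x x))
      = kd x w * (wt x * (kdc w 0 * (Sn a u w * Ab ι a 0 u w x x)))
        + wt x * (kdc x w * (kdc w 0 * (Sn a u w * Ab ι a 0 u w x x))) := by
    intro x
    rw [← mul_assoc (wt x) (kdc x w), mul_comm (wt x) (kdc x w), mul_assoc (kdc x w), ← add_mul, kd_add_kdc,
      one_mul]
  rw [tsum_congr hsplit, ENNReal.tsum_add, tsum_eq_single w (fun x hx => by rw [kd_of_ne hx, zero_mul]), kd_self,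
    one_mul]

/-- `R_R(ι,a) = [w = 0] + [w ≠ 0, x = w] + [w ≠ 0, x ≠ w]` (combining `rawRPiece_eq_at0_add_off0` with
`rawRPieceOff0_eq_diag_add_offDiag`).
[cite: FitznerVanDerHofstad2017, §4.4 (4.65) (arXiv:1506.07977v2 p. 43); Lemma 5.1 second version (p. 50)] -/
theorem rawRPiece_eq_at0_add_diag_add_offDiag (Sn : Fin 3 → Site d → Site d → ℝ≥0∞) (Ab : DirBlockFamily d)
    (ι : Fin d × Bool) (a : Fin 3) :
    rawRPiece Sn Ab ι a = rawRPieceAt0 Sn Ab ι a + rawRDiag Sn Ab ι a + rawROffDiag Sn Ab ι a := by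
  rw [rawRPiece_eq_at0_add_off0, rawRPieceOff0_eq_diag_add_offDiag, add_assoc]

/-- `[diagonal x = w] ≤ [w ≠ 0 part of R_R(ι,a)]`.
[cite: FitznerVanDerHofstad2017, §4.4 (4.65) (arXiv:1506.07977v2 p. 43); Lemma 5.1 second version (p. 50)] -/
theorem rawRDiag_le_rawRPieceOff0 (Sn : Fin 3 → Site d → Site d → ℝ≥0∞) (Ab : DirBlockFamily d)
    (ι : Fin d × Bool) (a : Fin 3) : rawRDiag Sn Ab ι a ≤ rawRPieceOff0 Sn Ab ι a := by
  rw [rawRPieceOff0_eq_diag_add_offDiag]; exact le_self_add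

/-- `[off-diagonal x ≠ w] ≤ [w ≠ 0 part of R_R(ι,a)]`.
[cite: FitznerVanDerHofstad2017, §4.4 (4.65) (arXiv:1506.07977v2 p. 43); Lemma 5.1 second version (p. 50)] -/
theorem rawROffDiag_le_rawRPieceOff0 (Sn : Fin 3 → Site d → Site d → ℝ≥0∞) (Ab : DirBlockFamily d)
    (ι : Fin d × Bool) (a : Fin 3) : rawROffDiag Sn Ab ι a ≤ rawRPieceOff0 Sn Ab ι a := by
  rw [rawRPieceOff0_eq_diag_add_offDiag]; exact le_add_self

/-- `R_R = Σ_{ι,a} [w = 0] + Σ_{ι,a} [w ≠ 0, x = w] + Σ_{ι,a} [w ≠ 0, x ≠ w]` (summed form of the three-way split).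
[cite: FitznerVanDerHofstad2017, §4.4 (4.65) (arXiv:1506.07977v2 p. 43); Lemma 5.1 second version (p. 50)] -/
theorem rawR_eq_sum_at0_add_sum_diag_add_sum_offDiag (Sn : Fin 3 → Site d → Site d → ℝ≥0∞) (Ab : DirBlockFamily d) :
    rawR Sn Ab = (∑ ι : Fin d × Bool, ∑ a : Fin 3, rawRPieceAt0 Sn Ab ι a)
      + (∑ ι : Fin d × Bool, ∑ a : Fin 3, rawRDiag Sn Ab ι a)
      + ∑ ι : Fin d × Bool, ∑ a : Fin 3, rawROffDiag Sn Ab ι a := by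
  simp only [rawR_eq_sum_rawRPiece, rawRPiece_eq_at0_add_diag_add_offDiag, Finset.sum_add_distrib]

/-! ## B. Left side trivial (`u = w = 0`): the diagonal `t = e_ι` and its complement -/

/-- **The diagonal `t = e_ι` of `R_L(ι,b)`**: `Σ_{x,z} ‖x‖₂² Ā^{ι,0,b}(0,0,e_ι,z) (P^E−u⃗)_b(e_ι−x,z−x)` — the
configurations of the left-trivial diagram (`u = w = 0`) in which the exit-triangle vertex `t` equals the far end
`e_ι` of the first pivotal bond (the App. B row `a = 0, b = 1` of `A^{ι,a,b}(0,v,x,y)` carries the Kronecker addend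
`δ_{x,e}` at this point, v2 p. 75). Object only; no bound is attached here.
[cite: FitznerVanDerHofstad2017, §4.4 (4.65) (arXiv:1506.07977v2 p. 43); Lemma 5.1 second version (p. 50)] -/
def rawLDiag (Ab : DirBlockFamily d) (En : Fin 3 → Site d → Site d → ℝ≥0∞) (ι : Fin d × Bool) (b : Fin 3) : ℝ≥0∞ :=
  ∑' x, ∑' z, wt x * (Ab ι 0 b 0 0 (stepVec ι) z * En b (stepVec ι - x) (z - x))

/-- **The off-diagonal `t ≠ e_ι` remainder of `R_L(ι,b)`**:
`Σ_{x,t,z} ‖x‖₂² (1 − δ_{t,e_ι}) Ā^{ι,0,b}(0,0,t,z) (P^E−u⃗)_b(t−x,z−x)`. Object only.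
[cite: FitznerVanDerHofstad2017, §4.4 (4.65) (arXiv:1506.07977v2 p. 43); Lemma 5.1 second version (p. 50)] -/
def rawLOffDiag (Ab : DirBlockFamily d) (En : Fin 3 → Site d → Site d → ℝ≥0∞) (ι : Fin d × Bool) (b : Fin 3) : ℝ≥0∞ :=
  ∑' x, ∑' t, ∑' z, wt x * (kdc t (stepVec ι) * (Ab ι 0 b 0 0 t z * En b (t - x) (z - x)))

/-- **`R_L(ι,b) = [diagonal t = e_ι] + [off-diagonal t ≠ e_ι]`**: the insertion of `1 = δ_{t,e_ι} + (1 − δ_{t,e_ι})`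
under the sum — elementary algebra over the tree's objects, valid for every four-point family `Ab` and every
exit-letter family `En`; not a case distinction made in print.
[cite: FitznerVanDerHofstad2017, §4.4 (4.65) (arXiv:1506.07977v2 p. 43); Lemma 5.1 second version (p. 50)] -/
theorem rawLPiece_eq_diag_add_offDiag (Ab : DirBlockFamily d) (En : Fin 3 → Site d → Site d → ℝ≥0∞)
    (ι : Fin d × Bool) (b : Fin 3) :
    rawLPiece Ab En ι b = rawLDiag Ab En ι b + rawLOffDiag Ab En ι b := by
  unfold rawLPiece rawLDiag rawLOffDiag
  rw [← ENNReal.tsum_add]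
  refine tsum_congr fun x => ?_
  have hsplit : ∀ t, ∑' z, wt x * (Ab ι 0 b 0 0 t z * En b (t - x) (z - x))
      = kd t (stepVec ι) * ∑' z, wt x * (Ab ι 0 b 0 0 t z * En b (t - x) (z - x))
        + ∑' z, wt x * (kdc t (stepVec ι) * (Ab ι 0 b 0 0 t z * En b (t - x) (z - x))) := by
    intro t
    rw [← ENNReal.tsum_mul_left, ← ENNReal.tsum_add]
    refine tsum_congr fun z => ?_
    rw [← mul_assoc (wt x) (kdc t _), mul_comm (wt x) (kdc t _), mul_assoc (kdc t _), ← add_mul, kd_add_kdc,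
      one_mul]
  rw [tsum_congr hsplit, ENNReal.tsum_add,
    tsum_eq_single (stepVec ι) (fun t ht => by rw [kd_of_ne ht, zero_mul]), kd_self, one_mul]

/-- `[diagonal t = e_ι] ≤ R_L(ι,b)`.
[cite: FitznerVanDerHofstad2017, §4.4 (4.65) (arXiv:1506.07977v2 p. 43); Lemma 5.1 second version (p. 50)] -/
theorem rawLDiag_le_rawLPiece (Ab : DirBlockFamily d) (En : Fin 3 → Site d → Site d → ℝ≥0∞) (ι : Fin d × Bool)
    (b : Fin 3) : rawLDiag Ab En ι b ≤ rawLPiece Ab En ι b := by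
  rw [rawLPiece_eq_diag_add_offDiag]; exact le_self_add

/-- `[off-diagonal t ≠ e_ι] ≤ R_L(ι,b)`.
[cite: FitznerVanDerHofstad2017, §4.4 (4.65) (arXiv:1506.07977v2 p. 43); Lemma 5.1 second version (p. 50)] -/
theorem rawLOffDiag_le_rawLPiece (Ab : DirBlockFamily d) (En : Fin 3 → Site d → Site d → ℝ≥0∞) (ι : Fin d × Bool)
    (b : Fin 3) : rawLOffDiag Ab En ι b ≤ rawLPiece Ab En ι b := by
  rw [rawLPiece_eq_diag_add_offDiag]; exact le_add_self

/-- `R_L = Σ_{ι,b} [t = e_ι] + Σ_{ι,b} [t ≠ e_ι]` (summed form of the split).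
[cite: FitznerVanDerHofstad2017, §4.4 (4.65) (arXiv:1506.07977v2 p. 43); Lemma 5.1 second version (p. 50)] -/
theorem rawL_eq_sum_diag_add_sum_offDiag (Ab : DirBlockFamily d) (En : Fin 3 → Site d → Site d → ℝ≥0∞) :
    rawL Ab En = (∑ ι : Fin d × Bool, ∑ b : Fin 3, rawLDiag Ab En ι b)
      + ∑ ι : Fin d × Bool, ∑ b : Fin 3, rawLOffDiag Ab En ι b := by
  simp only [rawL_eq_sum_rawLPiece, rawLPiece_eq_diag_add_offDiag, Finset.sum_add_distrib]

end Literature.Probability.FitznerVanDerHofstad2017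

end
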